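import Mathlib
import Summits.KontsevichZagierPeriods.KontsevichZagierPeriods.Theorems.SoloInformedLiftMoves
import Literature.NumberTheory.Transcendental.KZMellinFibres
import Literature.NumberTheory.Transcendental.KZDominatedFamilyRelations
import Literature.NumberTheory.Transcendental.KZGaussMultiplicationChain
import HarnessLib
import HarnessLib.Audit

/-!
# SoloInformed — the duplication chain `⟦[pt, 4^a]⟧·⟦β(a,a)⟧ = 2⟦β(a,½)⟧` (Theorem IX⁗, II)

**Theorem IX⁗ (duplication chain; `soloInformed_duplication_chain`).** For every rational `a` and
pinned representations `A = β(a,a)`, `B = β(a,½)` on `(0,1)`,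
`⟦[pt, 4^a]⟧ · ⟦A⟧ = 2 · ⟦B⟧` in the formal period ring `P` — Legendre's duplication formula
`4^a B(a,a) = 2 B(a,½)` DERIVED BY THE MOVES of KZ's calculus, with no appeal to `Γ`:
(i) drop the null point `t = ½` and split `(0,1) = (0,½) ∪ (½,1)` (move 1a);
(ii) reflect the upper half onto the lower half by `t ↦ 1 − t` (move 2; the integrand of
`β(a,a)` is symmetric), so `⟦A⟧ = 2⟦A|_{(0,½)}⟧` (`soloInformed_beta_symm_halving`);
(iii) ONE quadratic substitution `u = ψ₂(t) = 4t(1−t)` on `(0,½)` (move 2): since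
`1 − ψ₂ = (1−2t)²` and `ψ₂' = 4(1−2t)`, `u^{a−1}(1−u)^{−½} du = 4^a t^{a−1}(1−t)^{a−1} dt`, i.e.
`[4^a · A|_{(0,½)}] − [B] ∈ changeOfVariablesRel` (`soloInformed_duplication_mem_changeOfVariablesRel`);
(iv) relabel `⟦4^a · r⟧ = ⟦[pt,4^a]⟧⟦r⟧` (`toFormalPeriod_of_constMul`).
The multiplier `4^a` is in general an IRRATIONAL algebraic number (`√2` at `a = ¼`, `∛4²`… at
`a = ⅓`): together with the point field `K ⊂ P` (`SoloInformedAlgebraicHull.lean`) this places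
`⟦β(a,a)⟧` in the `K`-hull of `⟦β(a,½)⟧` for every rational `a`, complementing Euler's family
(Theorem IX′) and the `3`-isogeny chain (Theorem IX‴). `ψ₂` is the `2`-isogeny (Landen/Gauss step)
in the Beta coordinate.
Residency `solo-KontsevichZagierPeriods-informed` (s22); paper §6octies (rung S2).

References: M. Kontsevich, D. Zagier, *Periods* (2001), §1.2; A.-M. Legendre, *Exercices de calcul
intégral* I (1811) (duplication); A. Huber, S. Müller-Stach, *Periods and Nori motives* (2017), §13.1.
-/

noncomputable section

open MeasureTheory Set Filter
namespace Summit.KontsevichZagierPeriods.KontsevichZagierPeriods.Theorems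

open Literature.NumberTheory.Transcendental Literature.NumberTheory.Transcendental.KZ
open Literature.ModelTheory.ExponentialFields

/-! ### The duplication substitution `ψ₂(t) = 4t(1 − t)` on `(0, ½)` -/

/-- `ψ₂(t) = 4t(1−t)` (the `2`-isogeny / Landen step in the Beta coordinate). [this work] -/
def soloInformedDuplFun (t : ℝ) : ℝ := 4 * t * (1 - t)

/-- `ψ₂' = 4 − 8t`. [folklore] -/
theorem soloInformed_hasDerivAt_duplFun (t : ℝ) :
    HasDerivAt soloInformedDuplFun (4 - 8 * t) t := by
  have h := ((hasDerivAt_id' t).const_mul (4:ℝ)).mul ((hasDerivAt_id' t).const_sub 1)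
  have hfun : soloInformedDuplFun = fun y : ℝ => 4 * y * (1 - y) := rfl
  rw [hfun]
  refine h.congr_deriv ?_
  ring

/-- `1 − ψ₂(t) = (1 − 2t)²`. [folklore] -/
theorem soloInformed_one_sub_duplFun (t : ℝ) : 1 - soloInformedDuplFun t = (1 - 2 * t) ^ 2 := by
  unfold soloInformedDuplFun
  ring

/-- `ψ₂ > 0` on `(0,1)`. [folklore] -/
theorem soloInformed_duplFun_pos {t : ℝ} (h0 : 0 < t) (h1 : t < 1) :
    0 < soloInformedDuplFun t := by
  unfold soloInformedDuplFun
  have : 0 < 1 - t := by linarith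
  positivity

/-- `ψ₂ < 1` away from `t = ½`. [folklore] -/
theorem soloInformed_duplFun_lt_one {t : ℝ} (ht : t < 1 / 2) : soloInformedDuplFun t < 1 := by
  have h := soloInformed_one_sub_duplFun t
  have : 0 < (1 - 2 * t) ^ 2 := by
    have : 0 < 1 - 2 * t := by linarith
    positivity
  linarith

/-- `ψ₂` is continuous. [folklore] -/
theorem soloInformed_continuous_duplFun : Continuous soloInformedDuplFun := by
  unfold soloInformedDuplFun
  fun_prop

/-- `ψ₂` is strictly increasing on `[0, ½]`. [folklore] -/
theorem soloInformed_strictMonoOn_duplFun :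
    StrictMonoOn soloInformedDuplFun (Icc (0:ℝ) (1 / 2)) := by
  refine strictMonoOn_of_deriv_pos (convex_Icc 0 _)
    soloInformed_continuous_duplFun.continuousOn fun t ht => ?_
  rw [interior_Icc] at ht
  rw [(soloInformed_hasDerivAt_duplFun t).deriv]
  linarith [ht.2]

/-- `ψ₂` maps `(0, ½)` ONTO `(0, 1)`. [folklore] -/
theorem soloInformed_image_duplFun :
    soloInformedDuplFun '' Ioo (0:ℝ) (1 / 2) = Ioo (0:ℝ) 1 := by
  refine Subset.antisymm ?_ ?_
  · rintro _ ⟨t, ht, rfl⟩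
    exact ⟨soloInformed_duplFun_pos ht.1 (by linarith [ht.2]), soloInformed_duplFun_lt_one ht.2⟩
  · have h := intermediate_value_Ioo (by norm_num : (0:ℝ) ≤ 1 / 2)
      soloInformed_continuous_duplFun.continuousOn
    have h0 : soloInformedDuplFun 0 = 0 := by norm_num [soloInformedDuplFun]
    have h1 : soloInformedDuplFun (1 / 2) = 1 := by norm_num [soloInformedDuplFun]
    rwa [h0, h1] at h

/-- The lift of `ψ₂` is a `ℚ`-polynomial map, hence semialgebraic on any semialgebraic set.
[BCR 1998, §2.2] -/
theorem soloInformed_isSemialgebraicMapOn_lift_duplFun {D : Set (Fin 1 → ℝ)}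
    (hD : IsSemialgebraic ℚ D) : IsSemialgebraicMapOn ℚ D (soloInformedLift soloInformedDuplFun) := by
  refine IsSemialgebraicMapOn.of_forall hD fun j => ?_
  refine (isSemialgebraicFunOn_aeval hD
    (MvPolynomial.C 4 * MvPolynomial.X 0 * (1 - MvPolynomial.X 0))).congr fun x hx => ?_
  simp [soloInformedLift, soloInformedDuplFun]

/-- `b^a` is algebraic over `ℚ` for a natural base `b > 0` and a rational exponent `a`
(a root of `X^{den a} − b^{num a}`). [folklore] -/
theorem soloInformed_isAlgebraic_natCast_rpow_ratCast (b : ℕ) (hb : 0 < b) (a : ℚ) :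
    IsAlgebraic ℚ ((b : ℝ) ^ (a : ℝ)) := by
  have hb' : (0:ℝ) < b := by exact_mod_cast hb
  have hx : ((b : ℝ) ^ (a : ℝ)) ^ a.den = (((b : ℚ) ^ a.num : ℚ) : ℝ) := by
    rw [← Real.rpow_natCast, ← Real.rpow_mul hb'.le, Rat.cast_zpow, Rat.cast_natCast,
      ← Real.rpow_intCast]
    congr 1
    exact_mod_cast Rat.mul_den_eq_num a
  refine ⟨Polynomial.X ^ a.den - Polynomial.C ((b : ℚ) ^ a.num),
    (Polynomial.monic_X_pow_sub_C _ a.den_nz).ne_zero, ?_⟩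
  rw [map_sub, Polynomial.aeval_X_pow, Polynomial.aeval_C, hx, sub_eq_zero, eq_ratCast]

/-- **The integrand identity of the duplication move**: for `t ∈ (0, ½)`,
`4^a · t^{a−1}(1−t)^{a−1} = ψ₂(t)^{a−1} (1 − ψ₂(t))^{½−1} ψ₂'(t)`
(`(4t(1−t))^{a−1} = 4^{a−1} t^{a−1} (1−t)^{a−1}`, `(1−ψ₂)^{−½} = (1−2t)^{−1}`,
`ψ₂' = 4(1−2t)`, `4^{a−1} · 4 = 4^a`). [this work] -/
theorem soloInformed_duplication_integrand_identity (a : ℚ) {t : ℝ} (ht0 : 0 < t)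
    (ht : t < 1 / 2) :
    (4:ℝ) ^ (a : ℝ) * ((t ^ ((a : ℝ) - 1)) * (1 - t) ^ ((a : ℝ) - 1)) =
      soloInformedDuplFun t ^ ((a : ℝ) - 1) *
        (1 - soloInformedDuplFun t) ^ (((1 / 2 : ℚ) : ℝ) - 1) * |4 - 8 * t| := by
  have h12 : 0 < 1 - 2 * t := by linarith
  have h1t : 0 < 1 - t := by linarith
  have e1 : soloInformedDuplFun t ^ ((a : ℝ) - 1) =
      (4:ℝ) ^ ((a : ℝ) - 1) * (t ^ ((a : ℝ) - 1) * (1 - t) ^ ((a : ℝ) - 1)) := by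
    unfold soloInformedDuplFun
    rw [Real.mul_rpow (by positivity) h1t.le, Real.mul_rpow (by norm_num) ht0.le, mul_assoc]
  have e2 : (1 - soloInformedDuplFun t) ^ (((1 / 2 : ℚ) : ℝ) - 1) = (1 - 2 * t)⁻¹ := by
    rw [soloInformed_one_sub_duplFun]
    have : (1 - 2 * t) ^ 2 = (1 - 2 * t) ^ ((2:ℕ) : ℝ) := (Real.rpow_natCast _ 2).symm
    rw [this, ← Real.rpow_mul h12.le]
    push_cast
    norm_num
    exact Real.rpow_neg_one (1 - 2 * t)
  have e3 : (4:ℝ) ^ ((a : ℝ) - 1) = (4:ℝ) ^ (a : ℝ) / 4 := Real.rpow_sub_one (by norm_num) _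
  have h12' : (1 - 2 * t) ≠ 0 := h12.ne'
  rw [e1, e2, e3, abs_of_pos (by linarith)]
  have key : (1 - 2 * t)⁻¹ * (4 - 8 * t) = 4 := by
    rw [show (4:ℝ) - 8 * t = (1 - 2 * t) * 4 by ring, ← mul_assoc, inv_mul_cancel₀ h12', one_mul]
  calc (4:ℝ) ^ (a : ℝ) * (t ^ ((a : ℝ) - 1) * (1 - t) ^ ((a : ℝ) - 1))
      = (4:ℝ) ^ (a : ℝ) / 4 * (t ^ ((a : ℝ) - 1) * (1 - t) ^ ((a : ℝ) - 1)) *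
          ((1 - 2 * t)⁻¹ * (4 - 8 * t)) := by rw [key]; ring
    _ = _ := by ring

/-- **The duplication move**: for rational `a`, with `H` the lower half `(0,½)` of a pinned
`β(a,a)` and `B` a pinned `β(a,½)`, the substitution `u = 4t(1−t)` gives
`[4^a · H] − [B] ∈ changeOfVariablesRel`. [this work] -/
theorem soloInformed_duplication_mem_changeOfVariablesRel (a : ℚ)
    (h4 : IsAlgebraic ℚ ((4:ℝ) ^ (a : ℝ))) (H B : IntegralRep 1)
    (hHd : H.domain = {t | t 0 ∈ Ioo (0:ℝ) (1 / 2)})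
    (hHi : EqOn H.integrand (fun t => (t 0) ^ ((a : ℝ) - 1) * (1 - t 0) ^ ((a : ℝ) - 1)) H.domain)
    (hBd : B.domain = {t | t 0 ∈ Ioo (0:ℝ) 1})
    (hBi : EqOn B.integrand
      (fun t => (t 0) ^ ((a : ℝ) - 1) * (1 - t 0) ^ (((1 / 2 : ℚ) : ℝ) - 1)) B.domain) :
    of (H.constMul ((4:ℝ) ^ (a : ℝ)) h4) - of B ∈
      changeOfVariablesRel := by
  refine soloInformed_lift_mem_changeOfVariablesRel _ B (g' := fun t => 4 - 8 * t)
    (by rw [IntegralRep.domain_constMul, hHd]) hBd ?_ (fun t _ => soloInformed_hasDerivAt_duplFun t)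
    (soloInformed_strictMonoOn_duplFun.injOn.mono Ioo_subset_Icc_self) soloInformed_image_duplFun
    fun x hx => ?_
  · rw [IntegralRep.domain_constMul]
    exact soloInformed_isSemialgebraicMapOn_lift_duplFun H.isSemialgebraic_domain
  · have hx' : x 0 ∈ Ioo (0:ℝ) (1 / 2) := by
      rw [IntegralRep.domain_constMul, hHd] at hx
      exact hx
    have hΦ : soloInformedLift soloInformedDuplFun x ∈ B.domain := by
      rw [hBd]
      exact ⟨soloInformed_duplFun_pos hx'.1 (by linarith [hx'.2]),
        soloInformed_duplFun_lt_one hx'.2⟩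
    have hxH : x ∈ H.domain := by rw [hHd]; exact hx'
    rw [IntegralRep.integrand_constMul]
    dsimp only
    rw [hHi hxH, hBi hΦ]
    exact soloInformed_duplication_integrand_identity a hx'.1 hx'.2

/-! ### Halving a symmetric Beta integral: `⟦β(a,a)⟧ = 2 ⟦β(a,a)|_{(0,½)}⟧` -/

/-- **Reflection of the upper half onto the lower half** (`t ↦ 1 − t`, move 2): for a pinned
symmetric `β(a,a)`-representation `A`, `[A|_{(½,1)}] − [A|_{(0,½)}] ∈ relations`. [this work] -/
theorem soloInformed_upperHalf_sub_lowerHalf_mem_relations (a : ℚ) (A : IntegralRep 1)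
    (hAi : EqOn A.integrand (fun t => (t 0) ^ ((a : ℝ) - 1) * (1 - t 0) ^ ((a : ℝ) - 1)) A.domain)
    (hlo : {t : Fin 1 → ℝ | t 0 ∈ Ioo (0:ℝ) (1 / 2)} ⊆ A.domain)
    (hup : {t : Fin 1 → ℝ | t 0 ∈ Ioo (1 / 2 : ℝ) 1} ⊆ A.domain) :
    of (A.restrict _ soloInformed_isSemialgebraic_upperHalf hup) -
      of (A.restrict _ soloInformed_isSemialgebraic_lowerHalf hlo) ∈ relations := by
  refine of_sub_of_mem_relations_of_boxReflection (0 : Fin 1) ?_ fun x hx => ?_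
  · rw [IntegralRep.domain_restrict, IntegralRep.domain_restrict]
    ext x
    simp only [mem_setOf_eq, mem_preimage, boxReflection_apply_self, mem_Ioo]
    constructor <;> rintro ⟨h1, h2⟩ <;> constructor <;> linarith
  · rw [IntegralRep.domain_restrict] at hx
    rw [IntegralRep.integrand_restrict, IntegralRep.integrand_restrict, hAi (hup hx),
      hAi (hlo ?_)]
    · simp only [boxReflection_apply_self, sub_sub_cancel]
      ring
    · simp only [mem_setOf_eq, boxReflection_apply_self, mem_Ioo] at hx ⊢
      constructor <;> linarith [hx.1, hx.2]

/-- **Halving**: for a pinned symmetric `β(a,a)`-representation `A`,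
`⟦A⟧ = ⟦A|_{(0,½)}⟧ + ⟦A|_{(0,½)}⟧` in `P` (drop the null point `t = ½`, split, reflect).
[this work] -/
theorem soloInformed_beta_symm_halving (a : ℚ) (A : IntegralRep 1)
    (hAd : A.domain = {t | t 0 ∈ Ioo (0:ℝ) 1})
    (hAi : EqOn A.integrand (fun t => (t 0) ^ ((a : ℝ) - 1) * (1 - t 0) ^ ((a : ℝ) - 1)) A.domain)
    (hlo : {t : Fin 1 → ℝ | t 0 ∈ Ioo (0:ℝ) (1 / 2)} ⊆ A.domain) :
    toFormalPeriod (of A) =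
      toFormalPeriod (of (A.restrict _ soloInformed_isSemialgebraic_lowerHalf hlo)) +
        toFormalPeriod (of (A.restrict _ soloInformed_isSemialgebraic_lowerHalf hlo)) := by
  have hup : {t : Fin 1 → ℝ | t 0 ∈ Ioo (1 / 2 : ℝ) 1} ⊆ A.domain := fun x hx => by
    rw [hAd]
    simp only [mem_setOf_eq, mem_Ioo] at hx ⊢
    constructor <;> linarith [hx.1, hx.2]
  have hE : {t : Fin 1 → ℝ | t 0 ∈ Ioo (0:ℝ) (1 / 2)} ∪ {t : Fin 1 → ℝ | t 0 ∈ Ioo (1 / 2 : ℝ) 1} ⊆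
      A.domain := union_subset hlo hup
  -- (i) dropping the point `t = ½` costs nothing
  have hvol : volume (A.domain \ ({t : Fin 1 → ℝ | t 0 ∈ Ioo (0:ℝ) (1 / 2)} ∪
      {t : Fin 1 → ℝ | t 0 ∈ Ioo (1 / 2 : ℝ) 1})) = 0 := by
    refine measure_mono_null (fun x hx => ?_) (BallPeeling.volume_setOf_apply_eq_const 1 0 (1 / 2))
    rw [hAd] at hx
    simp only [Set.mem_sdiff, mem_setOf_eq, mem_union, mem_Ioo, not_or, not_and, not_lt] at hx
    obtain ⟨⟨h0, h1⟩, hlo', hup'⟩ := hx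
    have h2 : 1 / 2 ≤ x 0 := hlo' h0
    have h3 : x 0 ≤ 1 / 2 := by
      by_contra h
      exact absurd (hup' (not_le.mp h)) (not_le.2 h1)
    show x 0 = 1 / 2
    linarith
  have h1 := IntegralRep.of_sub_of_restrict_mem_relations A soloInformed_isSemialgebraic_halves hE hvol
  -- (ii) the union splits (disjoint open halves)
  have h2 : of (A.restrict _ soloInformed_isSemialgebraic_halves hE) -
      of (A.restrict _ soloInformed_isSemialgebraic_lowerHalf hlo) -
      of (A.restrict _ soloInformed_isSemialgebraic_upperHalf hup) ∈ relations := by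
    refine domainAddRel_subset_relations ⟨1, A.restrict _ soloInformed_isSemialgebraic_halves hE,
      A.restrict _ soloInformed_isSemialgebraic_lowerHalf hlo,
      A.restrict _ soloInformed_isSemialgebraic_upperHalf hup, rfl, ?_, fun _ _ => rfl,
      fun _ _ => rfl, rfl⟩
    rw [IntegralRep.domain_restrict, IntegralRep.domain_restrict]
    have : {t : Fin 1 → ℝ | t 0 ∈ Ioo (0:ℝ) (1 / 2)} ∩ {t : Fin 1 → ℝ | t 0 ∈ Ioo (1 / 2 : ℝ) 1} =
        ∅ := by
      ext x
      simp only [mem_inter_iff, mem_setOf_eq, mem_Ioo, mem_empty_iff_false, iff_false, not_and,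
        and_imp]
      intro _ h h' _
      linarith
    rw [this, measure_empty]
  -- (iii) the upper half reflects onto the lower half
  have h3 := soloInformed_upperHalf_sub_lowerHalf_mem_relations a A hAi hlo hup
  have h : of A - of (A.restrict _ soloInformed_isSemialgebraic_lowerHalf hlo) -
      of (A.restrict _ soloInformed_isSemialgebraic_lowerHalf hlo) ∈ relations := by
    have := relations.add_mem (relations.add_mem h1 h2) h3
    convert this using 1
    abel
  have h' := toFormalPeriod_eq_iff.mpr (show of A - (of (A.restrict _
      soloInformed_isSemialgebraic_lowerHalf hlo) +
      of (A.restrict _ soloInformed_isSemialgebraic_lowerHalf hlo)) ∈ relations by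
    rwa [← sub_sub])
  rw [h', map_add]

/-! ### THEOREM IX⁗ (duplication chain): `⟦[pt, 4^a]⟧ · ⟦β(a,a)⟧ = 2 ⟦β(a,½)⟧` -/

/-- **THEOREM IX⁗ (the duplication chain).** For every rational `a` and pinned representations
`A = β(a,a)`, `B = β(a,½)` on `(0,1)`:  `⟦[pt, 4^a]⟧ · ⟦A⟧ = 2 · ⟦B⟧` in the formal period ring —
Legendre's duplication `4^a B(a,a) = 2 B(a,½)` DERIVED BY THE MOVES (halving by the reflection
`t ↦ 1−t`, then the single quadratic substitution `u = 4t(1−t)` on `(0,½)`), with no appeal to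
`Γ`. The multiplier `4^a` is in general an IRRATIONAL algebraic number. [this work] -/
theorem soloInformed_duplication_chain (a : ℚ) (h4 : IsAlgebraic ℚ ((4:ℝ) ^ (a : ℝ)))
    (A B : IntegralRep 1)
    (hAd : A.domain = {t | t 0 ∈ Ioo (0:ℝ) 1})
    (hAi : EqOn A.integrand (fun t => (t 0) ^ ((a : ℝ) - 1) * (1 - t 0) ^ ((a : ℝ) - 1)) A.domain)
    (hBd : B.domain = {t | t 0 ∈ Ioo (0:ℝ) 1})
    (hBi : EqOn B.integrand
      (fun t => (t 0) ^ ((a : ℝ) - 1) * (1 - t 0) ^ (((1 / 2 : ℚ) : ℝ) - 1)) B.domain) :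
    toFormalPeriod (of (IntegralRep.unit.constMul ((4:ℝ) ^ (a : ℝ)) h4)) *
      toFormalPeriod (of A) = 2 * toFormalPeriod (of B) := by
  have hlo : {t : Fin 1 → ℝ | t 0 ∈ Ioo (0:ℝ) (1 / 2)} ⊆ A.domain := fun x hx => by
    rw [hAd]
    simp only [mem_setOf_eq, mem_Ioo] at hx ⊢
    constructor <;> linarith [hx.1, hx.2]
  set H := A.restrict _ soloInformed_isSemialgebraic_lowerHalf hlo with hH
  have hmove := changeOfVariablesRel_subset_relations
    (soloInformed_duplication_mem_changeOfVariablesRel a h4 H B rfl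
      (fun x hx => hAi (hlo hx)) hBd hBi)
  have hHB : toFormalPeriod (of (IntegralRep.unit.constMul ((4:ℝ) ^ (a : ℝ)) h4)) *
      toFormalPeriod (of H) = toFormalPeriod (of B) := by
    rw [← toFormalPeriod_of_constMul]
    exact toFormalPeriod_eq_iff.mpr hmove
  rw [soloInformed_beta_symm_halving a A hAd hAi hlo, mul_add, ← hH, hHB, two_mul]

/-- **Value form of the duplication chain**: `4^a · B(a,a) = 2 · B(a,½)` for pinned
representations (Legendre duplication, here a COROLLARY of the moves). [this work] -/
theorem soloInformed_duplication_value (a : ℚ) (A B : IntegralRep 1)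
    (hAd : A.domain = {t | t 0 ∈ Ioo (0:ℝ) 1})
    (hAi : EqOn A.integrand (fun t => (t 0) ^ ((a : ℝ) - 1) * (1 - t 0) ^ ((a : ℝ) - 1)) A.domain)
    (hBd : B.domain = {t | t 0 ∈ Ioo (0:ℝ) 1})
    (hBi : EqOn B.integrand
      (fun t => (t 0) ^ ((a : ℝ) - 1) * (1 - t 0) ^ (((1 / 2 : ℚ) : ℝ) - 1)) B.domain) :
    (4:ℝ) ^ (a : ℝ) * A.value = 2 * B.value := by
  have h4 : IsAlgebraic ℚ ((4:ℝ) ^ (a : ℝ)) := by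
    simpa using soloInformed_isAlgebraic_natCast_rpow_ratCast 4 (by norm_num) a
  have h := congr_arg evalP (soloInformed_duplication_chain a h4 A B hAd hAi hBd hBi)
  rw [map_mul, map_mul, evalP_toFormalPeriod_of, evalP_toFormalPeriod_of, evalP_toFormalPeriod_of,
    IntegralRep.value_constMul, IntegralRep.value_unit, mul_one, map_ofNat] at h
  exact h

end Summit.KontsevichZagierPeriods.KontsevichZagierPeriods.Theorems

end
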